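import Summits.HodgeConjecture.HodgeConjecture.Theorems.CYFormCasimirCYFormCarrierEightAntiInvolution
import HarnessLib

/-!
# Crux X1 `CYFormCarrierEight` (route `CYFormCasimir`, stmt-HodgeConjecture-23493), helper file 4:
# the OPERATOR CRITERION for `stub_cyform_exists` — a CY form from any rational, type-preserving
# involution exchanging `⋀⁴W` and `⋀⁴W^*`

research route conditional on HC_CM; not a corollary. Nothing here proves HC, HC_CM, the rung H2, X1, the route or
`stub_cyform_exists`; this is the ASSEMBLY STEP of the planned proof of `stub_cyform_exists` (skeleton
`Cruxes/CYFormCarrierEight/Lines/birth.lean`), isolating what remains: the construction of the operator.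

For a complex abelian eightfold `A` with `φ ≫ φ = -d` (`d > 0`), `E₊ = ⋀⁴W = weilClassesPlus A φ 2 d`,
`E₋ = ⋀⁴W^* = weilClassesMinus A φ 2 d`: ANY `ℂ`-linear `s : H⁴ → H⁴` with `s(E₋) ≤ E₊`, `s(E₊) ≤ E₋`, `s(s x) = x` on
`E₊`, `s` rational on the rational classes of `E₊ ⊔ E₋ = W_K ⊗ ℂ`, and `s` type-preserving on the pure-type classes of
`E₋`, yields `T := (𝟙 + s)(E₋)` satisfying the five `IsCYFormAt` clauses of X1 (`exists_cyForm_of_operator`; helper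
file 1 is the case `s = σ^*`). Friedman–Laza's Hodge star `⋆` (§3.5, Lemma 36 / Prop. 37: `K`-antilinear,
`SU_H`-equivariant, `⋆⋆ = (-1)ⁿ disc`, an involution after rescaling exactly when the discriminant is a norm, i.e. in
the HYPERBOLIC case) is such an operator on `W_K ⊗ ℂ`; its construction on the carriers is the remaining work.

References: FriedmanLaza2013 (§3.5 Lemma 36, Prop. 37), vanGeemen1994HodgeAV (4.9, 5.2, 6.12), MoonenZarhin1998WeilClasses (§1).
-/

-- `Summit.HodgeConjecture.HodgeConjecture.…` is the tree's mandated summit/problem namespace (single-problem summit).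
set_option linter.dupNamespace false
noncomputable section

open CategoryTheory
open Literature.AlgebraicTopology.SingularHomology
open Literature.AlgebraicGeometry.Motives
open Literature.AlgebraicGeometry.HodgeTheory

namespace Summit.HodgeConjecture.HodgeConjecture.Theorems.CYFormCarrier

/-! ## §1 Local versions of the graph lemmas of helper file 1 -/

section LinearAlgebra

variable {K V : Type*} [Field K] [AddCommGroup V] [Module K V]

/-- If `L` preserves a property `P` ON `S` and `S` is spanned by its `P`-classes, then `L(S)` is spanned by its
`P`-classes. [folklore] -/
theorem map_le_span_sep_of_forall_mem (L : V →ₗ[K] V) (S : Submodule K V) (P : V → Prop)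
    (hP : ∀ c ∈ S, P c → P (L c)) (hS : S ≤ Submodule.span K {c | c ∈ S ∧ P c}) :
    S.map L ≤ Submodule.span K {c | c ∈ S.map L ∧ P c} := by
  refine (Submodule.map_mono hS).trans ?_
  rw [Submodule.map_span, Submodule.span_le]
  rintro _ ⟨c, ⟨hcS, hcP⟩, rfl⟩
  exact Submodule.subset_span ⟨Submodule.mem_map_of_mem hcS, hP c hcS hcP⟩

variable (s : V →ₗ[K] V) (Ep Em : Submodule K V)

/-- `(1 + s)(E₊) ≤ (1 + s)(E₋)` when `s(E₊) ≤ E₋` and `s(s x) = x` on `E₊`. [folklore] -/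
theorem map_id_add_le_of_sq_on (hs' : Ep.map s ≤ Em) (hss : ∀ x ∈ Ep, s (s x) = x) :
    Ep.map (LinearMap.id + s) ≤ Em.map (LinearMap.id + s) := by
  rintro _ ⟨x, hx, rfl⟩
  refine ⟨s x, hs' (Submodule.mem_map_of_mem hx), ?_⟩
  rw [LinearMap.add_apply, LinearMap.id_apply, LinearMap.add_apply, LinearMap.id_apply, hss x hx, add_comm]

/-- `(1 + s)(E₊ ⊔ E₋) = (1 + s)(E₋)` under the same hypotheses. [folklore] -/
theorem map_id_add_sup_eq_on (hs' : Ep.map s ≤ Em) (hss : ∀ x ∈ Ep, s (s x) = x) :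
    (Ep ⊔ Em).map (LinearMap.id + s) = Em.map (LinearMap.id + s) := by
  rw [Submodule.map_sup]; exact sup_eq_right.2 (map_id_add_le_of_sq_on s Ep Em hs' hss)

end LinearAlgebra

/-! ## §2 The operator criterion -/

section Operator

variable {A : AbelianVariety ℂ} {d : ℕ} {φ : A ⟶ A}

/-- **Operator criterion for `stub_cyform_exists`.** Let `A` be a complex abelian eightfold, `φ ≫ φ = -d`, `d > 0`,
`E₊ = ⋀⁴W`, `E₋ = ⋀⁴W^*`, and `s` a `ℂ`-linear endomorphism of `H⁴(A(ℂ); ℂ)` with `s(E₋) ≤ E₊`, `s(E₊) ≤ E₋`,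
`s(s x) = x` for `x ∈ E₊`, `s c` rational for every rational `c ∈ E₊ ⊔ E₋`, and `s c` of type `(p, q)` for every
`c ∈ E₋` of type `(p, q)`, `p + q = 4`. Then `T = (𝟙 + s)(E₋)` satisfies the five `IsCYFormAt` clauses of X1 (inlined
verbatim). Friedman–Laza's rescaled Hodge star is such an `s` in the hyperbolic case. [cite: FriedmanLaza2013, §3.5 Lemma 36 and Prop. 37]
[cite: vanGeemen1994HodgeAV, 4.9 and proof of Thm. 6.12] [cite: MoonenZarhin1998WeilClasses, §1] -/
theorem exists_cyForm_of_operator (hd : 0 < d) (hA : A.dim = 2 * 4) (hφ : φ ≫ φ = -(d • 𝟙 A))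
    (s : complexBetti A.X (2 * 2) →ₗ[ℂ] complexBetti A.X (2 * 2))
    (hs : (weilClassesMinus A φ 2 d).map s ≤ weilClassesPlus A φ 2 d)
    (hs' : (weilClassesPlus A φ 2 d).map s ≤ weilClassesMinus A φ 2 d)
    (hss : ∀ x ∈ weilClassesPlus A φ 2 d, s (s x) = x)
    (hrat : ∀ c ∈ weilClassesOf A φ 2 d, IsRationalClass c → IsRationalClass (s c))
    (htyp : ∀ c ∈ weilClassesMinus A φ 2 d, ∀ p q : ℕ, p + q = 4 →
      IsOfHodgeType (2 * 4) A.X (2 * 2) p q c → IsOfHodgeType (2 * 4) A.X (2 * 2) p q (s c)) :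
    ∃ T : Submodule ℂ (complexBetti A.X (2 * 2)),
      T ≤ pullbackEigenclasses A φ (2 * 2)
            (fun x y => ((x : ℂ) + (y : ℂ) * Complex.I * (Real.sqrt d : ℂ)) ^ 4) ⊔
          pullbackEigenclasses A φ (2 * 2)
            (fun x y => ((x : ℂ) - (y : ℂ) * Complex.I * (Real.sqrt d : ℂ)) ^ 4) ∧
      T ⊓ pullbackEigenclasses A φ (2 * 2)
            (fun x y => ((x : ℂ) + (y : ℂ) * Complex.I * (Real.sqrt d : ℂ)) ^ 4) = ⊥ ∧
      Module.finrank ℂ T = 70 ∧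
      T ≤ Submodule.span ℂ {c | c ∈ T ∧ IsRationalClass c} ∧
      T ≤ Submodule.span ℂ {c | c ∈ T ∧ ∃ p q : ℕ, p + q = 4 ∧ IsOfHodgeType (2 * 4) A.X (2 * 2) p q c} := by
  have hX : IsSmoothProjective (2 * 4) A.X := isSmoothProjective_of_dim_eq' hA
  set Ep := weilClassesPlus A φ 2 d with hEp
  set Em := weilClassesMinus A φ 2 d with hEm
  have h0 : Ep ⊓ Em = ⊥ := weilClassesPlus_inf_weilClassesMinus two_pos hd
  refine ⟨Em.map (LinearMap.id + s), map_id_add_le_sup s Ep Em hs, map_id_add_inf_eq_bot s Ep Em hs h0,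
    ?_, ?_, ?_⟩
  · haveI := finite_complexBetti_abelianVariety A (2 * 2)
    rw [finrank_map_id_add s Ep Em hs h0, hEm, finrank_weilClassesMinus_eq_choose hd hφ 2,
      finrank_eigenspace_neg_eq_dim hd hφ, hA]
    decide
  · have h1 := map_le_span_sep_of_forall_mem (LinearMap.id + s) (Ep ⊔ Em) (fun c => IsRationalClass c)
      (fun c hc hcr => by
        rw [LinearMap.add_apply, LinearMap.id_apply]
        exact hcr.add (hrat c hc hcr))
      (weilClassesOf_le_span_isRationalClass hd hφ 2)
    rwa [map_id_add_sup_eq_on s Ep Em hs' hss] at h1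
  · exact map_le_span_sep_of_forall_mem (LinearMap.id + s) Em
      (fun c => ∃ p q : ℕ, p + q = 2 * 2 ∧ IsOfHodgeType (2 * 4) A.X (2 * 2) p q c)
      (fun c hc hct => by
        obtain ⟨p, q, hpq, hct⟩ := hct
        refine ⟨p, q, hpq, ?_⟩
        rw [LinearMap.add_apply, LinearMap.id_apply]
        exact hct.add hX (htyp c hc p q hpq hct))
      (weilClassesMinus_le_span_pureType hd hφ hX two_pos)

end Operator

end Summit.HodgeConjecture.HodgeConjecture.Theorems.CYFormCarrier

end
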